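import Summits.AtomisticToContinuum.BoseEinsteinCondensation.Theorems.BECInsertionCorrectorCorrectorClosureHoleKLS
import Summits.AtomisticToContinuum.BoseEinsteinCondensation.Theorems.BECInsertionCorrectorCorrectorClosureFirstOrderInput
import Summits.AtomisticToContinuum.BoseEinsteinCondensation.Theorems.BECInsertionCorrectorCorrectorClosureModeCount
import Summits.AtomisticToContinuum.BoseEinsteinCondensation.Theorems.BECInsertionCorrectorCorrectorClosureReductionToFactors
import Summits.AtomisticToContinuum.BoseEinsteinCondensation.Theorems.BECFeynmanVortexAreaVortexAreaToPeriodicBEC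
import Summits.AtomisticToContinuum.BoseEinsteinCondensation.Theses.BECSectorPoincareTwoScale
import HarnessLib

/-!
# Crux `CorrectorClosure` (stmt-AtomisticToContinuum-12058), line `insertion-mode-gaussian-domination` —
# the kernel-checked REDUCTION of the crux to hole-mode Gaussian domination (skeleton v2 with its three
# landed stubs S1 `stub_holeKLS` (p141192), S2 `stub_firstOrderInput` (p141534), S4 `stub_modeCount`
# (p143883) wired in; the open stubs S3/S5/S6/S7 appear as hypotheses BY SIGNATURE)

Supports (does not close) stmt-AtomisticToContinuum-12058, route `BECInsertionCorrector`. Filed so that the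
result of lead c6's cycle 1 is importable and citable by planners, and so that modus ponens is immediate when
any remaining factor lands (as `ReductionToFactors`, p122159, did for line `residue-area-law`):

* `f0Floor_of_remainderDomination` — REMAINDER DOMINATION (the heart S3, verbatim) ∧ NEAR-CONVEXITY
  (S5-body = item 9094 at `ε = 1`, for every admissible `v`) ∧ K1 ⊢ torus BEC of the true `(N+1)`-body
  Feynman–Kac ground state for bounded `v`: `f₀(Φ₀) = n_0/(N+1) ≥ c₁` at `L = sideLength ρ (N+1)`,
  `ρ < ρ₀(v)`, all large `N` (S1 hole-channel KLS + S2 K1-input + S4 `d = 3` count, all landed);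
* `correctorClosure_of_remainderDomination` — … ∧ REMOVAL FIDELITY (S6, shared factor 2) ∧ the UNBOUNDED
  CASE (S7, shared scope hole) ⊢ `CorrectorClosure` BY NAME; `…_energyConvexityWindow` the same with item
  9094 (`BECSectorPoincareTwoScale.EnergyConvexityWindow`) by name in place of the S5-body;
* `correctorClosure_of_holeModeDomination` — the same from the K1-FREE transfer target C⁺ =
  HoleModeDomination (`b₋(n) ≤ Bρ/p⁴` on `p² ≤ M₀²ρa` with no first-order hypothesis; C⁺ ⇒ S3 trivially),
  the statement a planner would file as the shared one-body infrared item of this crux (two powers weaker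
  than `BECGaussianDomination.GaussianDomination`, true in `d = 1`);

Vocabulary (tree only): hole state `a(φ_n)Φ₀ = modeAn L (planeWaveMode L n) (Φ₀ : ℂ)`, removal
susceptibility `b₋(n) = ‖Re a(φ_n)Φ₀/Θ₀‖²₋₁ + ‖Im a(φ_n)Φ₀/Θ₀‖²₋₁` (`hMinusOneSqW`, weight `Θ₀`), bath modes
`C_n = Σⱼcos(p·xⱼ)`, `S_n = Σⱼsin(p·xⱼ)`, `p = latticeVec (2π/L) n`. No new definitions; pure logic over landed
theorems (axioms propext / Classical.choice / Quot.sound).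
-/

noncomputable section

open MeasureTheory Filter Matrix
open scoped ENNReal NNReal BigOperators ComplexConjugate

namespace Summit.AtomisticToContinuum.BoseEinsteinCondensation.Theorems.CorrectorClosure.InsertionModeGaussianDomination

open Literature.MathematicalPhysics.QuantumManyBody.BoseGas
open Summit.AtomisticToContinuum.BoseEinsteinCondensation.Theses.BECInsertionCorrector
open Summit.AtomisticToContinuum.BoseEinsteinCondensation.Theorems.CorrectorClosure.Negative
  (sideLength_succ_pos)
open Summit.AtomisticToContinuum.BoseEinsteinCondensation.Theorems.CorrectorClosure.ResidueAreaLaw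
  (stub_groundStateExists taggedZeroModeOccupation_ofReal_eq)
open Summit.AtomisticToContinuum.BoseEinsteinCondensation.Theorems.CorrectorClosure.HealingScaleKacInsertion
  (stub_nearMinimiserRigidity)
open Summit.AtomisticToContinuum.BoseEinsteinCondensation.Theorems.VortexAreaToPeriodicBEC
  (lintegral_ne_top_of_bounded)

variable {N : ℕ}

/-- **Factor 1 from remainder domination (S3 as a hypothesis, verbatim) and near-convexity (S5-body for
every admissible `v`), given K1** — the quantifier bookkeeping of the line's closing with the LANDED stubs:
`M₀` from S4 (`stub_modeCount`, p143883) → `B₁, ρ₂` from S2 (`stub_firstOrderInput`, p141534, K1 consumed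
there) → `B, ρ₃` from `hR` → `ρ₄, c₁` from S4; eventually in `N ≥ 1`, S1 (`stub_holeKLS`, p141192) per mode
(`∫v < ∞` for bounded finite-range `v`) and S2 ∘ `hR` per window mode feed S4. [folklore] -/
theorem f0Floor_of_remainderDomination
    (hR : ∀ (v : ℝ → ℝ≥0∞), IsRepulsiveFiniteRange v → (∃ C : ℝ≥0, ∀ r, v r ≤ C) → ∀ (B₁ : ℝ), 0 <
      B₁ → ∀ (M₀ : ℝ), 0 < M₀ → ∃ B : ℝ, 0 < B ∧ ∃ ρ₃ : ℝ, 0 < ρ₃ ∧ ∀ ρ : ℝ, 0 < ρ → ρ < ρ₃ → ∀ᶠ N :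
      ℕ in atTop, ∀ (L : ℝ), L = sideLength ρ (N + 1) → (∃ C : ℝ≥0, ∀ x, periodizedPotential v L x ≤
      C) → ∀ (Θ₀ : Config N → ℝ), IsPeriodicGroundStateFK v L Θ₀ → Continuous Θ₀ → (∀ X, 0 < Θ₀ X) →
      ∀ (Φ₀ : Config (N + 1) → ℝ), IsPeriodicGroundStateFK v L Φ₀ → Continuous Φ₀ → (∀ X, 0 < Φ₀ X)
      → ∀ (n : Fin 3 → ℤ), n ≠ 0 → ‖latticeVec (2 * Real.pi / L) n‖ ^ 2 ≤ M₀ ^ 2 * ρ *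
      (scatteringLength v).toReal → hMinusOneSqW L Θ₀ (fun X => ∑ j, Real.cos (2 * Real.pi / L * ∑
      i, (n i : ℝ) * X j i)) + hMinusOneSqW L Θ₀ (fun X => ∑ j, Real.sin (2 * Real.pi / L * ∑ i, (n
      i : ℝ) * X j i)) ≤ ENNReal.ofReal (B₁ * N / max ((N : ℝ) / L ^ 3 * (scatteringLength
      v).toReal) ((2 * Real.pi / L) ^ 2 * ∑ i, (n i : ℝ) ^ 2)) → hMinusOneSqW L Θ₀ (fun Y => (modeAn
      L (planeWaveMode L n) (fun X => (Φ₀ X : ℂ)) Y).re / Θ₀ Y) + hMinusOneSqW L Θ₀ (fun Y =>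
      (modeAn L (planeWaveMode L n) (fun X => (Φ₀ X : ℂ)) Y).im / Θ₀ Y) ≤ ENNReal.ofReal (B * ρ /
      (‖latticeVec (2 * Real.pi / L) n‖ ^ 2) ^ 2))
    (hconvAll : ∀ v : ℝ → ℝ≥0∞, IsRepulsiveFiniteRange v → ∃ ρ₅ : ℝ, 0 < ρ₅ ∧ ∀ ρ : ℝ, 0 < ρ → ρ <
      ρ₅ → ∀ᶠ N : ℕ in atTop, 2 * periodicGroundStateEnergy v (N + 1) (sideLength ρ (N + 1)) ≤
      periodicGroundStateEnergy v (N + 2) (sideLength ρ (N + 1)) + periodicGroundStateEnergy v N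
      (sideLength ρ (N + 1)) + ENNReal.ofReal (Real.sqrt (ρ * (scatteringLength v).toReal) /
      sideLength ρ (N + 1)))
    (hK1 : StaticResponseBound) (v : ℝ → ℝ≥0∞) (hv : IsRepulsiveFiniteRange v)
    (hbdd : ∃ C : ℝ≥0, ∀ r, v r ≤ C) :
    ∃ ρ₀ : ℝ, 0 < ρ₀ ∧ ∀ ρ : ℝ, 0 < ρ → ρ < ρ₀ → ∃ c₁ : ℝ, 0 < c₁ ∧
      ∀ᶠ N : ℕ in atTop, ∀ (L : ℝ), L = sideLength ρ (N + 1) →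
        (∃ C : ℝ≥0, ∀ x, periodizedPotential v L x ≤ C) →
        ∀ (Θ₀ : Config N → ℝ), IsPeriodicGroundStateFK v L Θ₀ → Continuous Θ₀ → (∀ X, 0 < Θ₀ X) →
        ∀ (Φ₀ : Config (N + 1) → ℝ), IsPeriodicGroundStateFK v L Φ₀ → Continuous Φ₀ →
          (∀ X, 0 < Φ₀ X) →
          ENNReal.ofReal c₁ ≤ taggedZeroModeOccupation N L (fun X => (Φ₀ X : ℂ)) := by
  obtain ⟨M₀, hM₀, hCount⟩ := stub_modeCount v hv hbdd (hconvAll v hv)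
  obtain ⟨B₁, hB₁, ρ₂, hρ₂, hFO⟩ := stub_firstOrderInput hK1 v hv
  obtain ⟨B, hB, ρ₃, hρ₃, hR'⟩ := hR v hv hbdd B₁ hB₁ M₀ hM₀
  obtain ⟨ρ₄, hρ₄, c₁, hc₁, hC⟩ := hCount B hB
  have hint : (∫⁻ x : Space, v ‖x‖) ≠ ⊤ := lintegral_ne_top_of_bounded hv hbdd
  refine ⟨min ρ₂ (min ρ₃ ρ₄), lt_min hρ₂ (lt_min hρ₃ hρ₄), fun ρ hρ hρlt => ⟨c₁, hc₁, ?_⟩⟩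
  have hρ₂' : ρ < ρ₂ := lt_of_lt_of_le hρlt (min_le_left _ _)
  have hρ₃' : ρ < ρ₃ := lt_of_lt_of_le (lt_of_lt_of_le hρlt (min_le_right _ _)) (min_le_left _ _)
  have hρ₄' : ρ < ρ₄ := lt_of_lt_of_le (lt_of_lt_of_le hρlt (min_le_right _ _)) (min_le_right _ _)
  filter_upwards [hFO ρ hρ hρ₂', hR' ρ hρ hρ₃', hC ρ hρ hρ₄', eventually_ge_atTop 1] with N hFON hRN hCN hN1
    L hL_def hb Θ₀ hΘ hΘc hΘp Φ₀ hΦ hΦc hΦp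
  have hL : 0 < L := by rw [hL_def]; exact sideLength_succ_pos hρ N
  refine hCN L hL_def hb Θ₀ hΘ hΘc hΘp Φ₀ hΦ hΦc hΦp ?_ ?_
  · intro n hn b hb0 hdom
    exact stub_holeKLS v hv hint N hN1 L hL hb Θ₀ hΘ hΘc hΘp Φ₀ hΦ hΦc hΦp n hn b hb0 hdom
  · intro n hn hwin
    exact hRN L hL_def hb Θ₀ hΘ hΘc hΘp Φ₀ hΦ hΦc hΦp n hn hwin (hFON L hL_def hb Θ₀ hΘ hΘc hΘp n hn)

/-- **The residue floor from factor 1 in `f₀`-form and factor 2** (= `residueFloor_of_factors'` of p122159 with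
the window-transfer line deleted: the `f₀`-floor is a hypothesis on the FK ground state itself).
`A = L⁻³(∫Θ₀G)² ≥ L⁻³c₂∫G² = c₂f₀ ≥ c₁c₂`. [folklore] -/
theorem residueFloor_of_f0
    (hF0 : StaticResponseBound → ∀ v : ℝ → ℝ≥0∞, IsRepulsiveFiniteRange v →
      (∃ C : ℝ≥0, ∀ r, v r ≤ C) →
      ∃ ρ₀ : ℝ, 0 < ρ₀ ∧ ∀ ρ : ℝ, 0 < ρ → ρ < ρ₀ → ∃ c₁ : ℝ, 0 < c₁ ∧
        ∀ᶠ N : ℕ in atTop, ∀ (L : ℝ), L = sideLength ρ (N + 1) →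
          (∃ C : ℝ≥0, ∀ x, periodizedPotential v L x ≤ C) →
          ∀ (Θ₀ : Config N → ℝ), IsPeriodicGroundStateFK v L Θ₀ → Continuous Θ₀ → (∀ X, 0 < Θ₀ X) →
          ∀ (Φ₀ : Config (N + 1) → ℝ), IsPeriodicGroundStateFK v L Φ₀ → Continuous Φ₀ →
            (∀ X, 0 < Φ₀ X) →
            ENNReal.ofReal c₁ ≤ taggedZeroModeOccupation N L (fun X => (Φ₀ X : ℂ)))
    (hFid : StaticResponseBound → ∀ v : ℝ → ℝ≥0∞, IsRepulsiveFiniteRange v → (∃ C : ℝ≥0, ∀ r, v r ≤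
      C) → ∃ ρ₃ : ℝ, 0 < ρ₃ ∧ ∀ ρ : ℝ, 0 < ρ → ρ < ρ₃ → ∃ c₂ : ℝ, 0 < c₂ ∧ ∀ᶠ N : ℕ in atTop, ∀ (L :
      ℝ), L = sideLength ρ (N + 1) → (∃ C : ℝ≥0, ∀ x, periodizedPotential v L x ≤ C) → ∀ (Θ₀ :
      Config N → ℝ), IsPeriodicGroundStateFK v L Θ₀ → Continuous Θ₀ → (∀ X, 0 < Θ₀ X) → ∀ (Φ₀ :
      Config (N + 1) → ℝ), IsPeriodicGroundStateFK v L Φ₀ → Continuous Φ₀ → (∀ X, 0 < Φ₀ X) → ∀ (G :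
      Config N → ℝ), (G = fun X => ∫ x in cell L, Φ₀ (vecCons x X)) → ENNReal.ofReal c₂ * ∫⁻ X in
      cellN N L, ENNReal.ofReal (G X) ^ 2 ≤ ENNReal.ofReal ((∫ X in cellN N L, Θ₀ X * G X) ^ 2))
    (hK1 : StaticResponseBound) (v : ℝ → ℝ≥0∞) (hv : IsRepulsiveFiniteRange v)
    (hbdd : ∃ C : ℝ≥0, ∀ r, v r ≤ C) :
    ∃ ρ₂ : ℝ, 0 < ρ₂ ∧ ∀ ρ : ℝ, 0 < ρ → ρ < ρ₂ → ∃ c : ℝ, 0 < c ∧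
      ∀ᶠ N : ℕ in atTop, ∀ (L : ℝ), L = sideLength ρ (N + 1) →
        (∃ C : ℝ≥0, ∀ x, periodizedPotential v L x ≤ C) →
        ∀ (Θ₀ : Config N → ℝ), IsPeriodicGroundStateFK v L Θ₀ → Continuous Θ₀ → (∀ X, 0 < Θ₀ X) →
        ∀ (Φ₀ : Config (N + 1) → ℝ), IsPeriodicGroundStateFK v L Φ₀ → Continuous Φ₀ →
          (∀ X, 0 < Φ₀ X) →
          ENNReal.ofReal c ≤
            ENNReal.ofReal ((L ^ 3)⁻¹ *
              (∫ X in cellN N L, Θ₀ X * ∫ x in cell L, Φ₀ (vecCons x X)) ^ 2) := by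
  obtain ⟨ρ₀, hρ₀, hBEC₀⟩ := hF0 hK1 v hv hbdd
  obtain ⟨ρ₃, hρ₃, hFid₀⟩ := hFid hK1 v hv hbdd
  refine ⟨min ρ₀ ρ₃, lt_min hρ₀ hρ₃, fun ρ hρ hρlt => ?_⟩
  have hρ₀' : ρ < ρ₀ := lt_of_lt_of_le hρlt (min_le_left _ _)
  have hρ₃' : ρ < ρ₃ := lt_of_lt_of_le hρlt (min_le_right _ _)
  obtain ⟨c₁, hc₁, hBECc⟩ := hBEC₀ ρ hρ hρ₀'
  obtain ⟨c₂, hc₂, hFidc⟩ := hFid₀ ρ hρ hρ₃'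
  refine ⟨c₁ * c₂, by positivity, ?_⟩
  filter_upwards [hBECc, hFidc] with N hBECN hFidN L hL_def hb Θ₀ hΘ hΘc hΘp Φ₀ hΦ hΦc hΦp
  have hL : 0 < L := by rw [hL_def]; exact sideLength_succ_pos hρ N
  set G : Config N → ℝ := fun X => ∫ x in cell L, Φ₀ (vecCons x X) with hG_def
  -- factor 1: `c₁ ≤ f₀(Φ₀)` (hypothesis, FK form)
  have hf₀ : ENNReal.ofReal c₁ ≤ taggedZeroModeOccupation N L (fun X => (Φ₀ X : ℂ)) :=
    hBECN L hL_def hb Θ₀ hΘ hΘc hΘp Φ₀ hΦ hΦc hΦp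
  rw [taggedZeroModeOccupation_ofReal_eq L hΦp] at hf₀
  -- factor 2: `c₂ ∫ G² ≤ (∫ Θ₀ G)²`
  have hF : ENNReal.ofReal c₂ * ∫⁻ X in cellN N L, ENNReal.ofReal (G X) ^ 2 ≤
      ENNReal.ofReal ((∫ X in cellN N L, Θ₀ X * G X) ^ 2) :=
    hFidN L hL_def hb Θ₀ hΘ hΘc hΘp Φ₀ hΦ hΦc hΦp G rfl
  -- combine: `c₁ c₂ ≤ c₂ · (L³)⁻¹ ∫G² ≤ (L³)⁻¹ (∫Θ₀G)²`
  calc ENNReal.ofReal (c₁ * c₂)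
      = ENNReal.ofReal c₂ * ENNReal.ofReal c₁ := by
        rw [ENNReal.ofReal_mul hc₁.le, mul_comm]
    _ ≤ ENNReal.ofReal c₂ * ((ENNReal.ofReal L ^ 3)⁻¹ *
          ∫⁻ X in cellN N L, ENNReal.ofReal (G X) ^ 2) := by gcongr
    _ = (ENNReal.ofReal L ^ 3)⁻¹ *
          (ENNReal.ofReal c₂ * ∫⁻ X in cellN N L, ENNReal.ofReal (G X) ^ 2) := by ring
    _ ≤ (ENNReal.ofReal L ^ 3)⁻¹ * ENNReal.ofReal ((∫ X in cellN N L, Θ₀ X * G X) ^ 2) := by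
        gcongr
    _ = ENNReal.ofReal ((L ^ 3)⁻¹ * (∫ X in cellN N L, Θ₀ X * G X) ^ 2) := by
        rw [ENNReal.ofReal_mul (by positivity), ENNReal.ofReal_inv_of_pos (by positivity),
          ENNReal.ofReal_pow hL.le]

/-- **The crux unfolded (`StaticResponseBound → InsertionResidue`) from factor 1 in `f₀`-form, factor 2 and the
scope hole** (= `correctorClosure_of_factors` of p122159 with the `f₀`-form of factor 1). Unbounded `v`: `hUnb`.
Bounded `v`: thresholds `min ρᵢ`; eventually in `N` the torus FK ground states exist, are continuous and positive
with `v^per` bounded (`stub_groundStateExists`, p92339); the floor `c ≤ A`; rigidity at `ε = c/2`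
(`stub_nearMinimiserRigidity`, p85784) moves it to `c/2 ≤ Res(Θ, Ψ)` for some `δ`-near-minimiser `Θ` and every
`δ`-near-minimiser `Ψ`, `δ` AFTER `N` (Disproof §3/§7). [folklore] -/
theorem correctorClosure_of_f0
    (hF0 : StaticResponseBound → ∀ v : ℝ → ℝ≥0∞, IsRepulsiveFiniteRange v →
      (∃ C : ℝ≥0, ∀ r, v r ≤ C) →
      ∃ ρ₀ : ℝ, 0 < ρ₀ ∧ ∀ ρ : ℝ, 0 < ρ → ρ < ρ₀ → ∃ c₁ : ℝ, 0 < c₁ ∧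
        ∀ᶠ N : ℕ in atTop, ∀ (L : ℝ), L = sideLength ρ (N + 1) →
          (∃ C : ℝ≥0, ∀ x, periodizedPotential v L x ≤ C) →
          ∀ (Θ₀ : Config N → ℝ), IsPeriodicGroundStateFK v L Θ₀ → Continuous Θ₀ → (∀ X, 0 < Θ₀ X) →
          ∀ (Φ₀ : Config (N + 1) → ℝ), IsPeriodicGroundStateFK v L Φ₀ → Continuous Φ₀ →
            (∀ X, 0 < Φ₀ X) →
            ENNReal.ofReal c₁ ≤ taggedZeroModeOccupation N L (fun X => (Φ₀ X : ℂ)))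
    (hFid : StaticResponseBound → ∀ v : ℝ → ℝ≥0∞, IsRepulsiveFiniteRange v → (∃ C : ℝ≥0, ∀ r, v r ≤
      C) → ∃ ρ₃ : ℝ, 0 < ρ₃ ∧ ∀ ρ : ℝ, 0 < ρ → ρ < ρ₃ → ∃ c₂ : ℝ, 0 < c₂ ∧ ∀ᶠ N : ℕ in atTop, ∀ (L :
      ℝ), L = sideLength ρ (N + 1) → (∃ C : ℝ≥0, ∀ x, periodizedPotential v L x ≤ C) → ∀ (Θ₀ :
      Config N → ℝ), IsPeriodicGroundStateFK v L Θ₀ → Continuous Θ₀ → (∀ X, 0 < Θ₀ X) → ∀ (Φ₀ :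
      Config (N + 1) → ℝ), IsPeriodicGroundStateFK v L Φ₀ → Continuous Φ₀ → (∀ X, 0 < Φ₀ X) → ∀ (G :
      Config N → ℝ), (G = fun X => ∫ x in cell L, Φ₀ (vecCons x X)) → ENNReal.ofReal c₂ * ∫⁻ X in
      cellN N L, ENNReal.ofReal (G X) ^ 2 ≤ ENNReal.ofReal ((∫ X in cellN N L, Θ₀ X * G X) ^ 2))
    (hUnb : StaticResponseBound → ∀ v : ℝ → ℝ≥0∞, IsRepulsiveFiniteRange v → (¬ ∃ C : ℝ≥0, ∀ r, v r
      ≤ C) → ∃ ρ₀ : ℝ, 0 < ρ₀ ∧ ∀ ρ : ℝ, 0 < ρ → ρ < ρ₀ → ∃ c : ℝ, 0 < c ∧ ∀ᶠ N : ℕ in Filter.atTop,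
      ∃ δ : ENNReal, 0 < δ ∧ ∃ Θ : PeriodicTrialState N (sideLength ρ (N + 1)), periodicEnergy v Θ ≤
      periodicGroundStateEnergy v N (sideLength ρ (N + 1)) + δ ∧ ∀ Ψ : PeriodicTrialState (N + 1)
      (sideLength ρ (N + 1)), periodicEnergy v Ψ ≤ periodicGroundStateEnergy v (N + 1) (sideLength ρ
      (N + 1)) + δ → ENNReal.ofReal c ≤ ENNReal.ofReal ((sideLength ρ (N + 1) ^ 3)⁻¹) * (‖∫ X in
      cellN N (sideLength ρ (N + 1)), conj (Θ.ψ X) * ∫ x in cell (sideLength ρ (N + 1)), Ψ.ψ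
      (vecCons x X)‖₊ : ℝ≥0∞) ^ 2) :
    StaticResponseBound → InsertionResidue := by
  -- conclusion = the UNFOLDED crux (`CorrectorClosure := StaticResponseBound → InsertionResidue`)
  intro hK1 v hv
  by_cases hbdd : ∃ C : ℝ≥0, ∀ r, v r ≤ C
  swap
  · exact hUnb hK1 v hv hbdd
  obtain ⟨ρA, hρA, hGS⟩ := stub_groundStateExists v hv hbdd
  obtain ⟨ρ₂, hρ₂, hFl⟩ := residueFloor_of_f0 hF0 hFid hK1 v hv hbdd
  refine ⟨min ρA ρ₂, lt_min hρA hρ₂, fun ρ hρ hρlt => ?_⟩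
  have hρA' : ρ < ρA := lt_of_lt_of_le hρlt (min_le_left _ _)
  have hρ₂' : ρ < ρ₂ := lt_of_lt_of_le hρlt (min_le_right _ _)
  obtain ⟨c, hc, hFlc⟩ := hFl ρ hρ hρ₂'
  refine ⟨c / 2, by positivity, ?_⟩
  filter_upwards [hGS ρ hρ hρA', hFlc] with N hGSN hFlN
  obtain ⟨hb, ⟨hΘ, hΘc, hΘp⟩, ⟨hΦ, hΦc, hΦp⟩⟩ := hGSN
  set L : ℝ := sideLength ρ (N + 1) with hL_def
  have hL : 0 < L := sideLength_succ_pos hρ N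
  set Θ₀ : Config N → ℝ := periodicFKGroundState v N L with hΘ₀_def
  set Φ₀ : Config (N + 1) → ℝ := periodicFKGroundState v (N + 1) L with hΦ₀_def
  set A : ℝ≥0∞ := ENNReal.ofReal ((L ^ 3)⁻¹ *
      (∫ X in cellN N L, Θ₀ X * ∫ x in cell L, Φ₀ (vecCons x X)) ^ 2) with hA_def
  -- the floor: `c ≤ A`
  have hfloor : ENNReal.ofReal c ≤ A := hFlN L rfl hb Θ₀ hΘ hΘc hΘp Φ₀ hΦ hΦc hΦp
  -- rigidity at `ε = c/2`: transfer to the near-minimiser frame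
  obtain ⟨δ, hδ, Θ, hΘE, hΨ⟩ := stub_nearMinimiserRigidity v hv N L hL hb Θ₀ hΘ hΘc hΘp Φ₀ hΦ hΦc
    hΦp (c / 2) (by positivity)
  refine ⟨δ, hδ, Θ, hΘE, fun Ψ hΨE => ?_⟩
  set R : ℝ≥0∞ := ENNReal.ofReal ((L ^ 3)⁻¹) *
      (‖∫ X in cellN N L, conj (Θ.ψ X) * ∫ x in cell L, Ψ.ψ (vecCons x X)‖₊ : ℝ≥0∞) ^ 2 with hR_def
  have hAR : A ≤ R + ENNReal.ofReal (c / 2) := hΨ Ψ hΨE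
  have hsplit : ENNReal.ofReal c = ENNReal.ofReal (c / 2) + ENNReal.ofReal (c / 2) := by
    rw [← ENNReal.ofReal_add (by positivity) (by positivity)]
    congr 1; ring
  have h2 : ENNReal.ofReal (c / 2) + ENNReal.ofReal (c / 2) ≤ R + ENNReal.ofReal (c / 2) := by
    rw [← hsplit]; exact hfloor.trans hAR
  exact (ENNReal.add_le_add_iff_right ENNReal.ofReal_ne_top).1 h2

/-- **`CorrectorClosure` ⇐ remainder domination (S3) ∧ near-convexity (S5-body, all admissible `v`) ∧ removal
fidelity (S6) ∧ the unbounded case (S7)** — the crux BY NAME from its four open factors, the three provable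
stubs of line `insertion-mode-gaussian-domination` being landed. [folklore] -/
theorem correctorClosure_of_remainderDomination
    (hR : ∀ (v : ℝ → ℝ≥0∞), IsRepulsiveFiniteRange v → (∃ C : ℝ≥0, ∀ r, v r ≤ C) → ∀ (B₁ : ℝ), 0 <
      B₁ → ∀ (M₀ : ℝ), 0 < M₀ → ∃ B : ℝ, 0 < B ∧ ∃ ρ₃ : ℝ, 0 < ρ₃ ∧ ∀ ρ : ℝ, 0 < ρ → ρ < ρ₃ → ∀ᶠ N :
      ℕ in atTop, ∀ (L : ℝ), L = sideLength ρ (N + 1) → (∃ C : ℝ≥0, ∀ x, periodizedPotential v L x ≤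
      C) → ∀ (Θ₀ : Config N → ℝ), IsPeriodicGroundStateFK v L Θ₀ → Continuous Θ₀ → (∀ X, 0 < Θ₀ X) →
      ∀ (Φ₀ : Config (N + 1) → ℝ), IsPeriodicGroundStateFK v L Φ₀ → Continuous Φ₀ → (∀ X, 0 < Φ₀ X)
      → ∀ (n : Fin 3 → ℤ), n ≠ 0 → ‖latticeVec (2 * Real.pi / L) n‖ ^ 2 ≤ M₀ ^ 2 * ρ *
      (scatteringLength v).toReal → hMinusOneSqW L Θ₀ (fun X => ∑ j, Real.cos (2 * Real.pi / L * ∑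
      i, (n i : ℝ) * X j i)) + hMinusOneSqW L Θ₀ (fun X => ∑ j, Real.sin (2 * Real.pi / L * ∑ i, (n
      i : ℝ) * X j i)) ≤ ENNReal.ofReal (B₁ * N / max ((N : ℝ) / L ^ 3 * (scatteringLength
      v).toReal) ((2 * Real.pi / L) ^ 2 * ∑ i, (n i : ℝ) ^ 2)) → hMinusOneSqW L Θ₀ (fun Y => (modeAn
      L (planeWaveMode L n) (fun X => (Φ₀ X : ℂ)) Y).re / Θ₀ Y) + hMinusOneSqW L Θ₀ (fun Y =>
      (modeAn L (planeWaveMode L n) (fun X => (Φ₀ X : ℂ)) Y).im / Θ₀ Y) ≤ ENNReal.ofReal (B * ρ /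
      (‖latticeVec (2 * Real.pi / L) n‖ ^ 2) ^ 2))
    (hconvAll : ∀ v : ℝ → ℝ≥0∞, IsRepulsiveFiniteRange v → ∃ ρ₅ : ℝ, 0 < ρ₅ ∧ ∀ ρ : ℝ, 0 < ρ → ρ <
      ρ₅ → ∀ᶠ N : ℕ in atTop, 2 * periodicGroundStateEnergy v (N + 1) (sideLength ρ (N + 1)) ≤
      periodicGroundStateEnergy v (N + 2) (sideLength ρ (N + 1)) + periodicGroundStateEnergy v N
      (sideLength ρ (N + 1)) + ENNReal.ofReal (Real.sqrt (ρ * (scatteringLength v).toReal) /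
      sideLength ρ (N + 1)))
    (hFid : StaticResponseBound → ∀ v : ℝ → ℝ≥0∞, IsRepulsiveFiniteRange v → (∃ C : ℝ≥0, ∀ r, v r ≤
      C) → ∃ ρ₃ : ℝ, 0 < ρ₃ ∧ ∀ ρ : ℝ, 0 < ρ → ρ < ρ₃ → ∃ c₂ : ℝ, 0 < c₂ ∧ ∀ᶠ N : ℕ in atTop, ∀ (L :
      ℝ), L = sideLength ρ (N + 1) → (∃ C : ℝ≥0, ∀ x, periodizedPotential v L x ≤ C) → ∀ (Θ₀ :
      Config N → ℝ), IsPeriodicGroundStateFK v L Θ₀ → Continuous Θ₀ → (∀ X, 0 < Θ₀ X) → ∀ (Φ₀ :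
      Config (N + 1) → ℝ), IsPeriodicGroundStateFK v L Φ₀ → Continuous Φ₀ → (∀ X, 0 < Φ₀ X) → ∀ (G :
      Config N → ℝ), (G = fun X => ∫ x in cell L, Φ₀ (vecCons x X)) → ENNReal.ofReal c₂ * ∫⁻ X in
      cellN N L, ENNReal.ofReal (G X) ^ 2 ≤ ENNReal.ofReal ((∫ X in cellN N L, Θ₀ X * G X) ^ 2))
    (hUnb : StaticResponseBound → ∀ v : ℝ → ℝ≥0∞, IsRepulsiveFiniteRange v → (¬ ∃ C : ℝ≥0, ∀ r, v r
      ≤ C) → ∃ ρ₀ : ℝ, 0 < ρ₀ ∧ ∀ ρ : ℝ, 0 < ρ → ρ < ρ₀ → ∃ c : ℝ, 0 < c ∧ ∀ᶠ N : ℕ in Filter.atTop,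
      ∃ δ : ENNReal, 0 < δ ∧ ∃ Θ : PeriodicTrialState N (sideLength ρ (N + 1)), periodicEnergy v Θ ≤
      periodicGroundStateEnergy v N (sideLength ρ (N + 1)) + δ ∧ ∀ Ψ : PeriodicTrialState (N + 1)
      (sideLength ρ (N + 1)), periodicEnergy v Ψ ≤ periodicGroundStateEnergy v (N + 1) (sideLength ρ
      (N + 1)) + δ → ENNReal.ofReal c ≤ ENNReal.ofReal ((sideLength ρ (N + 1) ^ 3)⁻¹) * (‖∫ X in
      cellN N (sideLength ρ (N + 1)), conj (Θ.ψ X) * ∫ x in cell (sideLength ρ (N + 1)), Ψ.ψ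
      (vecCons x X)‖₊ : ℝ≥0∞) ^ 2) :
    CorrectorClosure :=
  correctorClosure_of_f0 (f0Floor_of_remainderDomination hR hconvAll) hFid hUnb

/-- **The same with item 9094 by name**: `EnergyConvexityWindow` (route BECSectorPoincareTwoScale) supplies the
S5-body (instantiate at `ε = 1`, shift `N ↦ N+1`, density of the box `sideLength ρ (N+1)` is exactly `ρ`).
[folklore] -/
theorem correctorClosure_of_remainderDomination_energyConvexityWindow
    (hR : ∀ (v : ℝ → ℝ≥0∞), IsRepulsiveFiniteRange v → (∃ C : ℝ≥0, ∀ r, v r ≤ C) → ∀ (B₁ : ℝ), 0 <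
      B₁ → ∀ (M₀ : ℝ), 0 < M₀ → ∃ B : ℝ, 0 < B ∧ ∃ ρ₃ : ℝ, 0 < ρ₃ ∧ ∀ ρ : ℝ, 0 < ρ → ρ < ρ₃ → ∀ᶠ N :
      ℕ in atTop, ∀ (L : ℝ), L = sideLength ρ (N + 1) → (∃ C : ℝ≥0, ∀ x, periodizedPotential v L x ≤
      C) → ∀ (Θ₀ : Config N → ℝ), IsPeriodicGroundStateFK v L Θ₀ → Continuous Θ₀ → (∀ X, 0 < Θ₀ X) →
      ∀ (Φ₀ : Config (N + 1) → ℝ), IsPeriodicGroundStateFK v L Φ₀ → Continuous Φ₀ → (∀ X, 0 < Φ₀ X)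
      → ∀ (n : Fin 3 → ℤ), n ≠ 0 → ‖latticeVec (2 * Real.pi / L) n‖ ^ 2 ≤ M₀ ^ 2 * ρ *
      (scatteringLength v).toReal → hMinusOneSqW L Θ₀ (fun X => ∑ j, Real.cos (2 * Real.pi / L * ∑
      i, (n i : ℝ) * X j i)) + hMinusOneSqW L Θ₀ (fun X => ∑ j, Real.sin (2 * Real.pi / L * ∑ i, (n
      i : ℝ) * X j i)) ≤ ENNReal.ofReal (B₁ * N / max ((N : ℝ) / L ^ 3 * (scatteringLength
      v).toReal) ((2 * Real.pi / L) ^ 2 * ∑ i, (n i : ℝ) ^ 2)) → hMinusOneSqW L Θ₀ (fun Y => (modeAn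
      L (planeWaveMode L n) (fun X => (Φ₀ X : ℂ)) Y).re / Θ₀ Y) + hMinusOneSqW L Θ₀ (fun Y =>
      (modeAn L (planeWaveMode L n) (fun X => (Φ₀ X : ℂ)) Y).im / Θ₀ Y) ≤ ENNReal.ofReal (B * ρ /
      (‖latticeVec (2 * Real.pi / L) n‖ ^ 2) ^ 2))
    (hECW :
      Summit.AtomisticToContinuum.BoseEinsteinCondensation.Theses.BECSectorPoincareTwoScale.EnergyConvexityWindow)
    (hFid : StaticResponseBound → ∀ v : ℝ → ℝ≥0∞, IsRepulsiveFiniteRange v → (∃ C : ℝ≥0, ∀ r, v r ≤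
      C) → ∃ ρ₃ : ℝ, 0 < ρ₃ ∧ ∀ ρ : ℝ, 0 < ρ → ρ < ρ₃ → ∃ c₂ : ℝ, 0 < c₂ ∧ ∀ᶠ N : ℕ in atTop, ∀ (L :
      ℝ), L = sideLength ρ (N + 1) → (∃ C : ℝ≥0, ∀ x, periodizedPotential v L x ≤ C) → ∀ (Θ₀ :
      Config N → ℝ), IsPeriodicGroundStateFK v L Θ₀ → Continuous Θ₀ → (∀ X, 0 < Θ₀ X) → ∀ (Φ₀ :
      Config (N + 1) → ℝ), IsPeriodicGroundStateFK v L Φ₀ → Continuous Φ₀ → (∀ X, 0 < Φ₀ X) → ∀ (G :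
      Config N → ℝ), (G = fun X => ∫ x in cell L, Φ₀ (vecCons x X)) → ENNReal.ofReal c₂ * ∫⁻ X in
      cellN N L, ENNReal.ofReal (G X) ^ 2 ≤ ENNReal.ofReal ((∫ X in cellN N L, Θ₀ X * G X) ^ 2))
    (hUnb : StaticResponseBound → ∀ v : ℝ → ℝ≥0∞, IsRepulsiveFiniteRange v → (¬ ∃ C : ℝ≥0, ∀ r, v r
      ≤ C) → ∃ ρ₀ : ℝ, 0 < ρ₀ ∧ ∀ ρ : ℝ, 0 < ρ → ρ < ρ₀ → ∃ c : ℝ, 0 < c ∧ ∀ᶠ N : ℕ in Filter.atTop,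
      ∃ δ : ENNReal, 0 < δ ∧ ∃ Θ : PeriodicTrialState N (sideLength ρ (N + 1)), periodicEnergy v Θ ≤
      periodicGroundStateEnergy v N (sideLength ρ (N + 1)) + δ ∧ ∀ Ψ : PeriodicTrialState (N + 1)
      (sideLength ρ (N + 1)), periodicEnergy v Ψ ≤ periodicGroundStateEnergy v (N + 1) (sideLength ρ
      (N + 1)) + δ → ENNReal.ofReal c ≤ ENNReal.ofReal ((sideLength ρ (N + 1) ^ 3)⁻¹) * (‖∫ X in
      cellN N (sideLength ρ (N + 1)), conj (Θ.ψ X) * ∫ x in cell (sideLength ρ (N + 1)), Ψ.ψ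
      (vecCons x X)‖₊ : ℝ≥0∞) ^ 2) :
    CorrectorClosure := by
  refine correctorClosure_of_remainderDomination hR (fun v hv => ?_) hFid hUnb
  obtain ⟨ρ₁, hρ₁, h⟩ := hECW v hv
  refine ⟨ρ₁, hρ₁, fun ρ hρ hρ₁' => ?_⟩
  have h2 := (tendsto_add_atTop_nat 1).eventually (h 1 one_pos ρ hρ hρ₁')
  filter_upwards [h2] with N hN
  have hL : 0 < sideLength ρ (N + 1) := sideLength_succ_pos hρ N
  have hdens : ((N + 1 : ℕ) : ℝ) / sideLength ρ (N + 1) ^ 3 = ρ :=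
    div_sideLength_pow_three hρ (Nat.succ_pos N)
  have hlo : ρ / 2 ≤ ((N + 1 : ℕ) : ℝ) / sideLength ρ (N + 1) ^ 3 := by rw [hdens]; linarith
  have hhi : ((N + 1 : ℕ) : ℝ) / sideLength ρ (N + 1) ^ 3 ≤ 2 * ρ := by rw [hdens]; linarith
  have h3 := hN (sideLength ρ (N + 1)) hL hlo hhi
  have h12 : N + 1 + 1 = N + 2 := rfl
  rw [h12, Nat.add_sub_cancel, one_mul] at h3
  exact h3

/-- **`CorrectorClosure` ⇐ HOLE-MODE GAUSSIAN DOMINATION (the K1-free transfer target C⁺ of the card: for every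
bounded admissible `v` and window `M₀`, `b₋(n) ≤ Bρ/p⁴` for the true torus ground states on `p² ≤ M₀²ρa`,
`N`-uniform at small `ρ`) ∧ near-convexity ∧ S6 ∧ S7.** C⁺ implies S3 by discarding S3's first-order hypothesis,
so this is `correctorClosure_of_remainderDomination` at once; it is the form in which the heart should be filed as
a shared item (the one-body infrared bound of this crux, two powers weaker than sibling `GaussianDomination`).
[folklore] -/
theorem correctorClosure_of_holeModeDomination
    (hHMD : ∀ (v : ℝ → ℝ≥0∞), IsRepulsiveFiniteRange v → (∃ C : ℝ≥0, ∀ r, v r ≤ C) → ∀ (M₀ : ℝ), 0 <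
      M₀ → ∃ B : ℝ, 0 < B ∧ ∃ ρ₃ : ℝ, 0 < ρ₃ ∧ ∀ ρ : ℝ, 0 < ρ → ρ < ρ₃ → ∀ᶠ N : ℕ in atTop, ∀ (L :
      ℝ), L = sideLength ρ (N + 1) → (∃ C : ℝ≥0, ∀ x, periodizedPotential v L x ≤ C) → ∀ (Θ₀ :
      Config N → ℝ), IsPeriodicGroundStateFK v L Θ₀ → Continuous Θ₀ → (∀ X, 0 < Θ₀ X) → ∀ (Φ₀ :
      Config (N + 1) → ℝ), IsPeriodicGroundStateFK v L Φ₀ → Continuous Φ₀ → (∀ X, 0 < Φ₀ X) → ∀ (n :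
      Fin 3 → ℤ), n ≠ 0 → ‖latticeVec (2 * Real.pi / L) n‖ ^ 2 ≤ M₀ ^ 2 * ρ * (scatteringLength
      v).toReal → hMinusOneSqW L Θ₀ (fun Y => (modeAn L (planeWaveMode L n) (fun X => (Φ₀ X : ℂ))
      Y).re / Θ₀ Y) + hMinusOneSqW L Θ₀ (fun Y => (modeAn L (planeWaveMode L n) (fun X => (Φ₀ X :
      ℂ)) Y).im / Θ₀ Y) ≤ ENNReal.ofReal (B * ρ / (‖latticeVec (2 * Real.pi / L) n‖ ^ 2) ^ 2))
    (hconvAll : ∀ v : ℝ → ℝ≥0∞, IsRepulsiveFiniteRange v → ∃ ρ₅ : ℝ, 0 < ρ₅ ∧ ∀ ρ : ℝ, 0 < ρ → ρ <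
      ρ₅ → ∀ᶠ N : ℕ in atTop, 2 * periodicGroundStateEnergy v (N + 1) (sideLength ρ (N + 1)) ≤
      periodicGroundStateEnergy v (N + 2) (sideLength ρ (N + 1)) + periodicGroundStateEnergy v N
      (sideLength ρ (N + 1)) + ENNReal.ofReal (Real.sqrt (ρ * (scatteringLength v).toReal) /
      sideLength ρ (N + 1)))
    (hFid : StaticResponseBound → ∀ v : ℝ → ℝ≥0∞, IsRepulsiveFiniteRange v → (∃ C : ℝ≥0, ∀ r, v r ≤
      C) → ∃ ρ₃ : ℝ, 0 < ρ₃ ∧ ∀ ρ : ℝ, 0 < ρ → ρ < ρ₃ → ∃ c₂ : ℝ, 0 < c₂ ∧ ∀ᶠ N : ℕ in atTop, ∀ (L :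
      ℝ), L = sideLength ρ (N + 1) → (∃ C : ℝ≥0, ∀ x, periodizedPotential v L x ≤ C) → ∀ (Θ₀ :
      Config N → ℝ), IsPeriodicGroundStateFK v L Θ₀ → Continuous Θ₀ → (∀ X, 0 < Θ₀ X) → ∀ (Φ₀ :
      Config (N + 1) → ℝ), IsPeriodicGroundStateFK v L Φ₀ → Continuous Φ₀ → (∀ X, 0 < Φ₀ X) → ∀ (G :
      Config N → ℝ), (G = fun X => ∫ x in cell L, Φ₀ (vecCons x X)) → ENNReal.ofReal c₂ * ∫⁻ X in
      cellN N L, ENNReal.ofReal (G X) ^ 2 ≤ ENNReal.ofReal ((∫ X in cellN N L, Θ₀ X * G X) ^ 2))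
    (hUnb : StaticResponseBound → ∀ v : ℝ → ℝ≥0∞, IsRepulsiveFiniteRange v → (¬ ∃ C : ℝ≥0, ∀ r, v r
      ≤ C) → ∃ ρ₀ : ℝ, 0 < ρ₀ ∧ ∀ ρ : ℝ, 0 < ρ → ρ < ρ₀ → ∃ c : ℝ, 0 < c ∧ ∀ᶠ N : ℕ in Filter.atTop,
      ∃ δ : ENNReal, 0 < δ ∧ ∃ Θ : PeriodicTrialState N (sideLength ρ (N + 1)), periodicEnergy v Θ ≤
      periodicGroundStateEnergy v N (sideLength ρ (N + 1)) + δ ∧ ∀ Ψ : PeriodicTrialState (N + 1)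
      (sideLength ρ (N + 1)), periodicEnergy v Ψ ≤ periodicGroundStateEnergy v (N + 1) (sideLength ρ
      (N + 1)) + δ → ENNReal.ofReal c ≤ ENNReal.ofReal ((sideLength ρ (N + 1) ^ 3)⁻¹) * (‖∫ X in
      cellN N (sideLength ρ (N + 1)), conj (Θ.ψ X) * ∫ x in cell (sideLength ρ (N + 1)), Ψ.ψ
      (vecCons x X)‖₊ : ℝ≥0∞) ^ 2) :
    CorrectorClosure :=
  correctorClosure_of_remainderDomination
    (fun v hv hbdd _B₁ _hB₁ M₀ hM₀ => by
      obtain ⟨B, hB, ρ₃, hρ₃, h⟩ := hHMD v hv hbdd M₀ hM₀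
      refine ⟨B, hB, ρ₃, hρ₃, fun ρ hρ hρ₃' => ?_⟩
      filter_upwards [h ρ hρ hρ₃'] with N hN L hL hb Θ₀ hΘ hΘc hΘp Φ₀ hΦ hΦc hΦp n hn hwin _hFO
      exact hN L hL hb Θ₀ hΘ hΘc hΘp Φ₀ hΦ hΦc hΦp n hn hwin)
    hconvAll hFid hUnb

end Summit.AtomisticToContinuum.BoseEinsteinCondensation.Theorems.CorrectorClosure.InsertionModeGaussianDomination

end
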